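import Summits.NavierStokesRegularity.NavierStokesRegularity.Theorems.StretchingWellBindingBindingCriterionSlab
import Summits.NavierStokesRegularity.NavierStokesRegularity.Theorems.ExtremiserTransienceNearExtremalTransiencePerFlowStretchingContinuity
import Summits.NavierStokesRegularity.NavierStokesRegularity.Theorems.ExtremiserTransiencePerFlowLockedTimesLogDensityPrelims
import Summits.NavierStokesRegularity.NavierStokesRegularity.Theorems.ExtremiserTransienceLocalMaximiserZoom
import Literature.Analysis.FluidPDE.ClassicalNSFiniteEnergyEquality
import HarnessLib

/-!
# Crux `NearExtremalTransiencePerFlow` (stmt-NavierStokesRegularity-26567) — REL: relative equilibria have zero stretching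

`--supports stmt-NavierStokesRegularity-26567` (helper; prover seat ns-net-p2 g12).  First lemma («REL») of the crux idea
`Cruxes/NearExtremalTransiencePerFlow/Ideas/nondegenerate-extremal-curve.md` (ns-idea-5 g12), text of record
`Cruxes/NearExtremalTransiencePerFlow/NondegenerateExtremalCurveSketch.lean` (`Sketch.RelEquilibriumNoStretching`, restated
VERBATIM as the type of `relEquilibriumNoStretching_holds`).

THEOREM.  A classical Leray–Hopf flow on `[0,T) × ℝ³` from rapidly decaying data which is SHAPE-PRESERVING modulo amplitude
and translation on a window, `u t x = a t • u t₀ (x − ξ t)` for `t ∈ [t₀, t₀ + s]` (`0 < t₀`, `0 < s`, `t₀ + s < T`), has zero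
vortex stretching at `t₀`: `∫⟪curl u(t₀), Du(t₀) curl u(t₀)⟫ = 0`.

PROOF (two balance laws, no Fourier argument).  Under the ansatz the energy, enstrophy, stretching and palinstrophy scale as
`K(t) = a(t)²K₀`, `Z(t) = a(t)²Z₀`, `J(t) = a(t)³J₀`, `P(t) = a(t)²P₀`.  On the closed slab `[0, t₀ + s]` the flow is in Tao's class
(`RungReynoldsOne.stub_taoCover`), so the energy equality (`IsClassicalNSSolutionOn.energyEq_finiteEnergy`, with
`∫|∇u|² = ∫|curl u|²` from `PerFlow.slab_slice_facts`) and the enstrophy balance (`DssBinding.vorticity_balance`) hold; with the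
continuity of `Z, P, J` they give `K' = −νZ` and `Z' = 2(J − νP)` at interior times.  Writing `g = K/K₀ = a²`:
`Z₀ g' = −ν g Z₀²/K₀` and `Z₀ g' = 2(a³J₀ − ν g P₀)`, whence `a³J₀ = a²·c` with a constant `c`; if `J₀ ≠ 0` this forces
`a(t) ∈ {0, c/J₀}` on `(t₀, t₀+s)`, and by continuity of `g` at `t₀` (`g(t₀) = 1`) `a ≡ c/J₀ ≠ 0` near `t₀⁺`, so `K` is constant
there while the energy equality dissipates `ν(t₂ − t₁)(c/J₀)²Z₀ > 0` — absurd.  (`Z₀ > 0 < K₀` because `J₀ ≠ 0`.)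
HONEST FRAMING: an elementary rigidity statement about classical solutions; nothing about Navier–Stokes regularity or blow-up
is proved; no summit is proved by a line. [folklore]
-/

noncomputable section

open scoped Topology InnerProductSpace RealInnerProductSpace ENNReal NNReal ContDiff
open MeasureTheory Filter Set Metric Function
open Literature.Analysis Literature.Analysis.FluidPDE
open Summit.NavierStokesRegularity.NavierStokesRegularity.Theorems.NearExtremalTransiencePerFlow.LocalMaximiser

namespace Summit.NavierStokesRegularity.NavierStokesRegularity.Theorems.NearExtremalTransiencePerFlow.DepletedFraction

-- the summit's namespace repeats the problem name by convention (D-0017)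
set_option linter.dupNamespace false
set_option linter.style.longLine false

/-! ## §1 Scaling of the four integrals under `x ↦ a • φ (x − ξ)` -/

section Scaling

variable (a : ℝ) (ξ : EuclideanSpace ℝ (Fin 3)) (φ : EuclideanSpace ℝ (Fin 3) → EuclideanSpace ℝ (Fin 3))

/-- The ansatz `x ↦ a • φ (x − ξ)` is the affine zoom `azoom a 1 (−ξ) φ`. -/
theorem smul_translate_eq_azoom : (fun x => a • φ (x - ξ)) = azoom a 1 (-ξ) φ := by
  funext x; rw [azoom_apply, one_smul, neg_add_eq_sub]

/-- Energy scaling: `∫‖a•φ(x−ξ)‖² = a² ∫‖φ‖²`. -/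
theorem integral_norm_sq_smul_translate :
    ∫ x, ‖a • φ (x - ξ)‖ ^ 2 = a ^ 2 * ∫ x, ‖φ x‖ ^ 2 := by
  have h : ∀ x, ‖a • φ (x - ξ)‖ ^ 2 = a ^ 2 * ‖φ (x - ξ)‖ ^ 2 := fun x => by
    rw [norm_smul, mul_pow, Real.norm_eq_abs, sq_abs]
  simp_rw [h]
  rw [integral_const_mul, integral_sub_right_eq_self (fun x => ‖φ x‖ ^ 2) ξ]

/-- Enstrophy scaling: `∫‖curl(a•φ(·−ξ))‖² = a² ∫‖curl φ‖²`. -/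
theorem integral_curl_sq_smul_translate :
    ∫ x, ‖curl (fun x => a • φ (x - ξ)) x‖ ^ 2 = a ^ 2 * ∫ x, ‖curl φ x‖ ^ 2 := by
  rw [smul_translate_eq_azoom]
  have h : ∀ x, ‖curl (azoom a 1 (-ξ) φ) x‖ ^ 2 = a ^ 2 * ‖curl φ (x - ξ)‖ ^ 2 := fun x => by
    have := zd_azoom a 1 (-ξ) φ x
    simp only [zd, mul_one, one_smul, neg_add_eq_sub] at this
    exact this
  simp_rw [h]
  rw [integral_const_mul, integral_sub_right_eq_self (fun x => ‖curl φ x‖ ^ 2) ξ]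

/-- Stretching scaling: `∫⟪curl v, Dv curl v⟫ = a³ ∫⟪curl φ, Dφ curl φ⟫` for `v = a•φ(·−ξ)`. -/
theorem integral_stretching_smul_translate :
    ∫ x, ⟪curl (fun x => a • φ (x - ξ)) x, fderiv ℝ (fun x => a • φ (x - ξ)) x (curl (fun x => a • φ (x - ξ)) x)⟫_ℝ =
      a ^ 3 * ∫ x, ⟪curl φ x, fderiv ℝ φ x (curl φ x)⟫_ℝ := by
  rw [smul_translate_eq_azoom]
  have h : ∀ x, ⟪curl (azoom a 1 (-ξ) φ) x, fderiv ℝ (azoom a 1 (-ξ) φ) x (curl (azoom a 1 (-ξ) φ) x)⟫_ℝ =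
      a ^ 3 * ⟪curl φ (x - ξ), fderiv ℝ φ (x - ξ) (curl φ (x - ξ))⟫_ℝ := fun x => by
    have := sd_azoom a 1 (-ξ) φ x
    simp only [sd, mul_one, one_smul, neg_add_eq_sub] at this
    exact this
  simp_rw [h]
  rw [integral_const_mul, integral_sub_right_eq_self (fun x => ⟪curl φ x, fderiv ℝ φ x (curl φ x)⟫_ℝ) ξ]

/-- Palinstrophy scaling: `∫|∇curl(a•φ(·−ξ))|²_F = a² ∫|∇curl φ|²_F`. -/
theorem integral_palinstrophy_smul_translate :
    ∫ x, frobeniusNormSq (fderiv ℝ (curl (fun x => a • φ (x - ξ))) x) =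
      a ^ 2 * ∫ x, frobeniusNormSq (fderiv ℝ (curl φ) x) := by
  rw [smul_translate_eq_azoom]
  have h : ∀ x, frobeniusNormSq (fderiv ℝ (curl (azoom a 1 (-ξ) φ)) x) =
      a ^ 2 * frobeniusNormSq (fderiv ℝ (curl φ) (x - ξ)) := fun x => by
    have := wd_azoom a 1 (-ξ) φ x
    simp only [wd, mul_one, one_smul, neg_add_eq_sub] at this
    exact this
  simp_rw [h]
  rw [integral_const_mul, integral_sub_right_eq_self (fun x => frobeniusNormSq (fderiv ℝ (curl φ) x)) ξ]

end Scaling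


/-! ## §2 Positivity of energy and enstrophy at a slice with non-zero stretching -/

/-- A field with non-zero total stretching has a point of non-zero vorticity. -/
theorem exists_curl_ne_zero_of_stretching_ne_zero {φ : EuclideanSpace ℝ (Fin 3) → EuclideanSpace ℝ (Fin 3)}
    (hJ : (∫ x, ⟪curl φ x, fderiv ℝ φ x (curl φ x)⟫_ℝ) ≠ 0) : ∃ x, curl φ x ≠ 0 := by
  by_contra h
  push Not at h
  apply hJ
  simp [h]

/-- A field with non-zero total stretching is not identically zero. -/
theorem exists_ne_zero_of_stretching_ne_zero {φ : EuclideanSpace ℝ (Fin 3) → EuclideanSpace ℝ (Fin 3)}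
    (hJ : (∫ x, ⟪curl φ x, fderiv ℝ φ x (curl φ x)⟫_ℝ) ≠ 0) : ∃ x, φ x ≠ 0 := by
  obtain ⟨x₀, hx₀⟩ := exists_curl_ne_zero_of_stretching_ne_zero hJ
  by_contra h
  push Not at h
  have hφ : φ = 0 := funext h
  apply hx₀
  rw [hφ]
  exact curl_zero x₀

/-- `∫‖f‖² > 0` for a continuous square-integrable field which does not vanish identically. -/
theorem integral_norm_sq_pos {f : EuclideanSpace ℝ (Fin 3) → EuclideanSpace ℝ (Fin 3)} (hf : Continuous f)
    (hint : Integrable (fun x => ‖f x‖ ^ 2)) {x₀ : EuclideanSpace ℝ (Fin 3)} (hx : f x₀ ≠ 0) :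
    0 < ∫ x, ‖f x‖ ^ 2 := by
  rw [integral_pos_iff_support_of_nonneg (fun x => sq_nonneg _) hint]
  have hsupp : (Function.support fun x => ‖f x‖ ^ 2) = f ⁻¹' {0}ᶜ := by
    ext x; simp
  have hopen : IsOpen (Function.support fun x => ‖f x‖ ^ 2) := by
    rw [hsupp]; exact isOpen_compl_singleton.preimage hf
  exact hopen.measure_pos volume ⟨x₀, by simp [hx]⟩

/-! ## §3 REL -/

/-- **REL — relative equilibria (amplitude × translations) of classical Leray–Hopf flows have zero vortex stretching.**
Type = the body of `Cruxes/NearExtremalTransiencePerFlow/NondegenerateExtremalCurveSketch.lean :: Sketch.RelEquilibriumNoStretching`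
VERBATIM. [folklore] -/
theorem relEquilibriumNoStretching_holds :
    ∀ (ν T : ℝ), 0 < ν → 0 < T →
    ∀ (u : ℝ → EuclideanSpace ℝ (Fin 3) → EuclideanSpace ℝ (Fin 3)) (p : ℝ → EuclideanSpace ℝ (Fin 3) → ℝ),
      IsClassicalNSSolutionOn (Set.Ico 0 T) ν 0 u p → IsLerayHopfOn T ν 0 (u 0) u → HasRapidSpatialDecay (u 0) →
    ∀ (t₀ s : ℝ), 0 < t₀ → 0 < s → t₀ + s < T →
      (∃ (a : ℝ → ℝ) (ξ : ℝ → EuclideanSpace ℝ (Fin 3)), ∀ t ∈ Set.Icc t₀ (t₀ + s), ∀ x, u t x = a t • u t₀ (x - ξ t)) →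
      ∫ x, ⟪curl (u t₀) x, fderiv ℝ (u t₀) x (curl (u t₀) x)⟫_ℝ = 0 := by
  intro ν T hν hT u p hsol hLH hdec t₀ s ht₀ hs hT₀s hshape
  obtain ⟨a, ξ, hshape⟩ := hshape
  by_contra hJ0
  -- the closed slab `[0, T']`, `T' = t₀ + s`, is in Tao's class
  set T' : ℝ := t₀ + s with hT'def
  have hT'0 : 0 < T' := by rw [hT'def]; linarith
  have hT'T : T' < T := hT₀s
  obtain ⟨q, hsolq, hBq, hBtq, -⟩ := RungReynoldsOne.stub_taoCover hν hT hsol hLH hdec ⟨hT'0, hT'T⟩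
  -- the four functions of time
  set Z : ℝ → ℝ := fun t => ∫ x, ‖curl (u t) x‖ ^ 2 with hZdef
  set P : ℝ → ℝ := fun t => ∫ x, frobeniusNormSq (fderiv ℝ (curl (u t)) x) with hPdef
  set J : ℝ → ℝ := fun t => ∫ x, ⟪curl (u t) x, fderiv ℝ (u t) x (curl (u t) x)⟫_ℝ with hJdef
  set K : ℝ → ℝ := fun t => VectorCalculus.kineticEnergy (u t) with hKdef
  have hJ0' : J t₀ ≠ 0 := hJ0
  -- positivity of `Z t₀` and `K t₀`
  have hφ : ContDiff ℝ ∞ (u t₀) := hsol.contDiff_velocity ⟨ht₀.le, by linarith⟩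
  have hφ2 : ContDiff ℝ 2 (u t₀) := hφ.of_le (by norm_cast)
  obtain ⟨x₁, hx₁⟩ := exists_curl_ne_zero_of_stretching_ne_zero hJ0'
  obtain ⟨x₂, hx₂⟩ := exists_ne_zero_of_stretching_ne_zero hJ0'
  have hZ0pos : 0 < Z t₀ := by
    have ht₀' : t₀ ∈ Icc 0 T' := ⟨ht₀.le, by rw [hT'def]; linarith⟩
    obtain ⟨C₁, hC₁⟩ := hBq 1
    have h1 : ∫⁻ x, ‖iteratedFDeriv ℝ 1 (u t₀) x‖ₑ ^ 2 < ⊤ := (hC₁ t₀ ht₀').trans_lt ENNReal.coe_lt_top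
    have hcurl_lt : ∫⁻ x, ‖curl (u t₀) x‖ₑ ^ 2 < ⊤ := by
      calc ∫⁻ x, ‖curl (u t₀) x‖ₑ ^ 2 ≤ ∫⁻ x, 6 * ‖iteratedFDeriv ℝ 1 (u t₀) x‖ₑ ^ 2 :=
            lintegral_mono fun x => RungReynoldsOne.enorm_curl_sq_le_six_mul (u t₀) x
        _ = 6 * ∫⁻ x, ‖iteratedFDeriv ℝ 1 (u t₀) x‖ₑ ^ 2 := lintegral_const_mul' _ _ (by norm_num)
        _ < ⊤ := ENNReal.mul_lt_top (by norm_num) h1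
    have hcc : Continuous (curl (u t₀)) := (contDiff_curl (n := 1) hφ2).continuous
    exact integral_norm_sq_pos hcc (integrable_sq_norm_of_lintegral_lt_top hcc hcurl_lt) hx₁
  have hK0pos : 0 < K t₀ := by
    have hint : Integrable (fun x => ‖u t₀ x‖ ^ 2) :=
      (hLH.memLp t₀ ⟨ht₀.le, by linarith⟩).integrable_norm_pow two_ne_zero
    have := integral_norm_sq_pos hφ.continuous hint hx₂
    show 0 < 2⁻¹ * ∫ x, ‖u t₀ x‖ ^ 2
    positivity
  -- scaling identities on the window
  have hscale : ∀ t ∈ Icc t₀ T', Z t = a t ^ 2 * Z t₀ ∧ P t = a t ^ 2 * P t₀ ∧ J t = a t ^ 3 * J t₀ ∧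
      K t = a t ^ 2 * K t₀ := by
    intro t ht
    have hu : u t = fun x => a t • u t₀ (x - ξ t) := funext (hshape t ht)
    refine ⟨?_, ?_, ?_, ?_⟩
    · show (∫ x, ‖curl (u t) x‖ ^ 2) = a t ^ 2 * ∫ x, ‖curl (u t₀) x‖ ^ 2
      rw [hu]; exact integral_curl_sq_smul_translate _ _ _
    · show (∫ x, frobeniusNormSq (fderiv ℝ (curl (u t)) x)) = a t ^ 2 * ∫ x, frobeniusNormSq (fderiv ℝ (curl (u t₀)) x)
      rw [hu]; exact integral_palinstrophy_smul_translate _ _ _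
    · show (∫ x, ⟪curl (u t) x, fderiv ℝ (u t) x (curl (u t) x)⟫_ℝ) =
          a t ^ 3 * ∫ x, ⟪curl (u t₀) x, fderiv ℝ (u t₀) x (curl (u t₀) x)⟫_ℝ
      rw [hu]; exact integral_stretching_smul_translate _ _ _
    · show VectorCalculus.kineticEnergy (u t) = a t ^ 2 * VectorCalculus.kineticEnergy (u t₀)
      unfold VectorCalculus.kineticEnergy
      rw [hu, integral_norm_sq_smul_translate]; ring
  -- continuity of `Z, P, J` on the slab and the enstrophy balance
  obtain ⟨hZcont, hPcont⟩ := DepletionLadder.PerFlow.continuousOn_enstrophy_palinstrophy_slab hT'0 hsolq hBq hBtq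
  have hJcont := ZoneTransversality.continuousOn_stretching_slab hT'0 hsolq hBq hBtq
  obtain ⟨-, hfint, hZeq⟩ := DssBinding.vorticity_balance hT'0 hsolq hBq hBtq
  -- the energy equality, with the dissipation expressed through the enstrophy
  have hfe : ∃ A : ℝ≥0∞, A < ⊤ ∧ ∀ t ∈ Icc 0 T', ∫⁻ x, ‖u t x‖ₑ ^ 2 ≤ A :=
    ⟨ENNReal.ofReal (2 * VectorCalculus.kineticEnergy (u 0)), ENNReal.ofReal_lt_top,
      fun t ht => hLH.lintegral_enorm_sq_le hν.le ⟨ht.1, ht.2.trans hT'T.le⟩⟩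
  have hdiss : ∀ s' t : ℝ, 0 ≤ s' → s' ≤ t → t ≤ T' →
      (∫⁻ τ in Ioo s' t, ∫⁻ x, ENNReal.ofReal (frobeniusNormSq (fderiv ℝ (u τ) x))).toReal = ∫ τ in s'..t, Z τ := by
    intro s' t hs' hst ht
    have h1 : ∫⁻ τ in Ioo s' t, ∫⁻ x, ENNReal.ofReal (frobeniusNormSq (fderiv ℝ (u τ) x)) =
        ∫⁻ τ in Ioo s' t, ENNReal.ofReal (Z τ) := by
      refine setLIntegral_congr_fun measurableSet_Ioo (fun τ hτ => ?_)
      have hτ' : τ ∈ Icc 0 T' := ⟨hs'.trans hτ.1.le, hτ.2.le.trans ht⟩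
      obtain ⟨e1, e2⟩ := DepletionLadder.PerFlow.slab_slice_facts hsolq hBq τ hτ'
      rw [e2, ← e1]
    have hint : IntegrableOn Z (Ioo s' t) :=
      ((hZcont.mono (Icc_subset_Icc hs' ht)).integrableOn_compact isCompact_Icc).mono_set Ioo_subset_Icc_self
    have hnn : 0 ≤ ∫ τ in Ioo s' t, Z τ := setIntegral_nonneg measurableSet_Ioo fun τ _ => integral_nonneg fun x => sq_nonneg _
    rw [h1, ← ofReal_integral_eq_lintegral_ofReal hint (Eventually.of_forall fun τ => integral_nonneg fun x => sq_nonneg _),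
      ENNReal.toReal_ofReal hnn, intervalIntegral.integral_of_le hst, integral_Ioc_eq_integral_Ioo]
  have henergy : ∀ s' t : ℝ, 0 ≤ s' → s' ≤ t → t ≤ T' → K t + ν * ∫ τ in s'..t, Z τ = K s' := by
    intro s' t hs' hst ht
    have h := hsolq.energyEq_finiteEnergy hν hT'0 hfe hs' hst ht
    rw [hdiss s' t hs' hst ht] at h
    exact h
  -- derivatives at interior times: `K' = −νZ`, `Z' = 2(J − νP)`
  have hIoo_nhds : ∀ t ∈ Ioo 0 T', Ioo 0 T' ∈ 𝓝 t := fun t ht => Ioo_mem_nhds ht.1 ht.2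
  have hKderiv : ∀ t ∈ Ioo 0 T', HasDerivAt K (0 - ν * Z t) t := by
    intro t ht
    have hprim : HasDerivAt (fun τ => ∫ x in (0:ℝ)..τ, Z x) (Z t) t :=
      intervalIntegral.integral_hasDerivAt_right
        ((hZcont.mono (Icc_subset_Icc_right ht.2.le)).intervalIntegrable_of_Icc ht.1.le)
        ((hZcont.mono Ioo_subset_Icc_self).stronglyMeasurableAtFilter isOpen_Ioo t ht)
        (hZcont.continuousAt (Icc_mem_nhds ht.1 ht.2))
    have h2 : HasDerivAt (fun τ => K 0 - ν * ∫ x in (0:ℝ)..τ, Z x) (0 - ν * Z t) t :=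
      (hasDerivAt_const t (K 0)).sub (hprim.const_mul ν)
    refine h2.congr_of_eventuallyEq ?_
    filter_upwards [hIoo_nhds t ht] with τ hτ
    have := henergy 0 τ le_rfl hτ.1.le hτ.2.le
    linarith
  have hZderiv : ∀ t ∈ Ioo 0 T', HasDerivAt Z (2 * (J t - ν * P t)) t := by
    intro t ht
    have hfcont : ContinuousOn (fun τ => 2 * ((∫ x, ⟪curl (u τ) x, fderiv ℝ (u τ) x (curl (u τ) x)⟫_ℝ) -
        ν * ∫ x, frobeniusNormSq (fderiv ℝ (curl (u τ)) x))) (Icc 0 T') :=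
      continuousOn_const.mul (hJcont.sub (continuousOn_const.mul hPcont))
    have hprim : HasDerivAt (fun b => ∫ τ in (0:ℝ)..b, 2 * ((∫ x, ⟪curl (u τ) x, fderiv ℝ (u τ) x (curl (u τ) x)⟫_ℝ) -
        ν * ∫ x, frobeniusNormSq (fderiv ℝ (curl (u τ)) x))) (2 * (J t - ν * P t)) t :=
      intervalIntegral.integral_hasDerivAt_right
        ((hfcont.mono (Icc_subset_Icc_right ht.2.le)).intervalIntegrable_of_Icc ht.1.le)
        ((hfcont.mono Ioo_subset_Icc_self).stronglyMeasurableAtFilter isOpen_Ioo t ht)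
        (hfcont.continuousAt (Icc_mem_nhds ht.1 ht.2))
    have h2 := (hasDerivAt_const t (Z 0)).add hprim
    rw [zero_add] at h2
    refine h2.congr_of_eventuallyEq ?_
    filter_upwards [hIoo_nhds t ht] with τ hτ
    exact hZeq τ ⟨hτ.1, hτ.2.le⟩
  -- `g = K/K₀` equals `a²` on the window; `Z = g Z₀` there
  set g : ℝ → ℝ := fun t => K t / K t₀ with hgdef
  have hK0ne : K t₀ ≠ 0 := hK0pos.ne'
  have hg_eq : ∀ t ∈ Icc t₀ T', g t = a t ^ 2 := by
    intro t ht
    show K t / K t₀ = a t ^ 2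
    rw [(hscale t ht).2.2.2, mul_div_assoc, div_self hK0ne, mul_one]
  have hgderiv : ∀ t ∈ Ioo 0 T', HasDerivAt g ((0 - ν * Z t) / K t₀) t := fun t ht =>
    (hKderiv t ht).div_const (K t₀)
  have ht₀I : t₀ ∈ Ioo 0 T' := ⟨ht₀, by rw [hT'def]; linarith⟩
  have hsubI : Ioo t₀ T' ⊆ Ioo 0 T' := Ioo_subset_Ioo_left ht₀.le
  -- the pointwise identity `a³ J₀ = a² c` on the open window
  set c : ℝ := ν * P t₀ - ν * Z t₀ * Z t₀ / (2 * K t₀) with hcdef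
  have hdich : ∀ t ∈ Ioo t₀ T', a t ^ 3 * J t₀ = a t ^ 2 * c := by
    intro t ht
    have htI : t ∈ Ioo 0 T' := hsubI ht
    obtain ⟨hZt, hPt, hJt, -⟩ := hscale t (Ioo_subset_Icc_self ht)
    -- `Z = g • Z₀` near `t`
    have hZg : HasDerivAt Z ((0 - ν * Z t) / K t₀ * Z t₀) t := by
      refine ((hgderiv t htI).mul_const (Z t₀)).congr_of_eventuallyEq ?_
      filter_upwards [Ioo_mem_nhds ht.1 ht.2] with τ hτ
      rw [(hscale τ (Ioo_subset_Icc_self hτ)).1, hg_eq τ (Ioo_subset_Icc_self hτ)]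
    have huniq : 2 * (J t - ν * P t) = (0 - ν * Z t) / K t₀ * Z t₀ := (hZderiv t htI).unique hZg
    rw [hZt, hPt, hJt] at huniq
    rw [hcdef]
    field_simp at huniq
    field_simp
    linarith
  -- hence `a ∈ {0, c/J₀}` there
  have hval : ∀ t ∈ Ioo t₀ T', a t ≠ 0 → a t = c / J t₀ := by
    intro t ht hat
    have h := hdich t ht
    rw [eq_div_iff hJ0']
    have h2 : a t ^ 2 * (a t * J t₀ - c) = 0 := by
      have : a t ^ 3 * J t₀ - a t ^ 2 * c = 0 := sub_eq_zero.2 h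
      linear_combination this
    rcases mul_eq_zero.1 h2 with h3 | h3
    · exact absurd (pow_eq_zero_iff two_ne_zero |>.1 h3) hat
    · linarith
  -- continuity of `g` at `t₀`, `g t₀ = 1`: `g > 1/2` on a right neighbourhood
  have hg0 : g t₀ = 1 := div_self hK0ne
  have hgcont : ContinuousAt g t₀ := (hgderiv t₀ ht₀I).continuousAt
  have hev : ∀ᶠ τ in 𝓝 t₀, (1 : ℝ) / 2 < g τ :=
    hgcont.eventually_const_lt (by rw [hg0]; norm_num)
  obtain ⟨δ, hδpos, hδ⟩ := Metric.eventually_nhds_iff.1 hev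
  set δ₁ : ℝ := min δ s with hδ₁
  have hδ₁pos : 0 < δ₁ := lt_min hδpos hs
  have hδ₁δ : δ₁ ≤ δ := min_le_left _ _
  have hδ₁s : δ₁ ≤ s := min_le_right _ _
  set t₁ : ℝ := t₀ + δ₁ / 3 with ht₁
  set t₂ : ℝ := t₀ + 2 * δ₁ / 3 with ht₂
  have hκ : ∀ τ ∈ Icc t₁ t₂, a τ = c / J t₀ := by
    intro τ hτ
    have hτ1 : t₀ < τ := by rw [ht₁] at hτ; linarith [hτ.1]
    have hτ2 : τ < T' := by rw [ht₂] at hτ; rw [hT'def]; linarith [hτ.2]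
    have hτI : τ ∈ Ioo t₀ T' := ⟨hτ1, hτ2⟩
    have hdist : dist τ t₀ < δ := by
      rw [Real.dist_eq, abs_of_pos (sub_pos.2 hτ1)]
      rw [ht₂] at hτ; linarith [hτ.2]
    have hgτ : (1 : ℝ) / 2 < g τ := hδ hdist
    have haτ : a τ ≠ 0 := by
      intro h0
      rw [hg_eq τ (Ioo_subset_Icc_self hτI), h0] at hgτ
      norm_num at hgτ
    exact hval τ hτI haτ
  -- on `[t₁, t₂]` the energy is constant while the dissipation is positive: contradiction
  set κ : ℝ := c / J t₀ with hκdef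
  have ht₁₂ : t₁ ≤ t₂ := by rw [ht₁, ht₂]; linarith
  have ht₁0 : 0 ≤ t₁ := by rw [ht₁]; linarith
  have ht₂T : t₂ ≤ T' := by rw [ht₂, hT'def]; linarith
  have ht₁mem : t₁ ∈ Icc t₁ t₂ := ⟨le_rfl, ht₁₂⟩
  have ht₂mem : t₂ ∈ Icc t₁ t₂ := ⟨ht₁₂, le_rfl⟩
  have hIcc_sub : Icc t₁ t₂ ⊆ Icc t₀ T' := fun τ hτ =>
    ⟨by rw [ht₁] at hτ; linarith [hτ.1], hτ.2.trans ht₂T⟩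
  have hκpos : 0 < κ ^ 2 := by
    have h1 : (1 : ℝ) / 2 < g t₁ := by
      refine hδ ?_
      rw [Real.dist_eq, ht₁, abs_of_pos (by linarith)]; linarith
    rw [hg_eq t₁ (hIcc_sub ht₁mem), hκ t₁ ht₁mem] at h1
    linarith
  have hK1 : K t₁ = κ ^ 2 * K t₀ := by rw [(hscale t₁ (hIcc_sub ht₁mem)).2.2.2, hκ t₁ ht₁mem]
  have hK2 : K t₂ = κ ^ 2 * K t₀ := by rw [(hscale t₂ (hIcc_sub ht₂mem)).2.2.2, hκ t₂ ht₂mem]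
  have hZint : ∫ τ in t₁..t₂, Z τ = (t₂ - t₁) * (κ ^ 2 * Z t₀) := by
    have hcongr : ∫ τ in t₁..t₂, Z τ = ∫ τ in t₁..t₂, κ ^ 2 * Z t₀ := by
      refine intervalIntegral.integral_congr fun τ hτ => ?_
      rw [uIcc_of_le ht₁₂] at hτ
      show Z τ = κ ^ 2 * Z t₀
      rw [(hscale τ (hIcc_sub hτ)).1, hκ τ hτ]
    rw [hcongr, intervalIntegral.integral_const, smul_eq_mul]
  have hE := henergy t₁ t₂ ht₁0 ht₁₂ ht₂T
  rw [hK1, hK2, hZint] at hE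
  have hgap : 0 < t₂ - t₁ := by rw [ht₁, ht₂]; linarith
  have : 0 < ν * ((t₂ - t₁) * (κ ^ 2 * Z t₀)) := by positivity
  linarith

end Summit.NavierStokesRegularity.NavierStokesRegularity.Theorems.NearExtremalTransiencePerFlow.DepletedFraction

end
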